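import Literature.Computability.Complexity.IsolationAdvice
import Literature.Computability.Complexity.StockmeyerMachines
import Literature.Computability.Complexity.PromiseRPAmplification
import Literature.Computability.Complexity.SigmaPRelClosure
import Literature.Computability.Complexity.CountingHierarchyPH
import HarnessLib

/-!
# The Valiant–Vazirani reduction at language level: `NP ⊆ RP^A` for every oracle `A` that
# decides UNIQUE-witness instances

L. G. Valiant, V. V. Vazirani, *NP is as easy as detecting unique solutions*, Theoret. Comput.
Sci. 47 (1986) 85–93, Thm. 1.1 with its Corollary ("if UNIQUE SAT is solvable in randomized
polynomial time then NP = RP"); S. Arora, B. Barak, *Computational Complexity: A Modern Approach*,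
CUP 2009, Thm. 17.18 and Lemma 17.19.  REPRODUCED HERE (machine-free, over the tree's coin-hash
layout of `StockmeyerEstimator.lean` and its Valiant–Vazirani count
`Stockmeyer.card_le_eight_mul_card_isolating` of `IsolationAdvice.lean`): the randomized
polynomial-time ORACLE reduction itself, as a membership `ExWitness R ∈ rp (P^A)`.

* Formats (total parsing, every string is an instance): `ExWitness R` — `z` with
  `(x, t) = boolUnpair z` is a member iff `#{y ∈ {0,1}^{|t|} | ⟨x, y⟩ ∈ R} > 0`;
  `UniqueWitness R` — the promise problem YES: that count is `1`, NO: it is `0`.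
* `hashRel R` — the HASHED relation: instance `x' = ⟨⟨x, t⟩, ⟨κ, u⟩⟩`, witness `y`; holds iff
  `⟨x, y⟩ ∈ R` and `y` hashes to `0^{|κ|}` under the first `|κ|` rows of the affine hash read off
  the coins `u` (`Stockmeyer.HashesToZero u |t| |κ| y`); `hashRel R ∈ P` for `R ∈ P`
  (`hashRel_mem_P`), and its witness count is the tree's `levelCount`
  (`countWitnesses_hashRel`).
* **`exWitness_mem_rp`** (VV86 Thm. 1.1 in oracle form): if a language `A` answers YES on the
  YES-instances and NO on the NO-instances of `UniqueWitness (hashRel R)` (no constraint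
  elsewhere), then `ExWitness R ∈ rp (PRel (Oracle.ofLanguage A))`: on `z`, draw `8` independent
  coin blocks `u` of length `(|z|+2)(|z|+1)`, and accept iff for some block and some level
  `k < |⟨z,u⟩|` the oracle accepts `⟨⟨⟨x,t⟩,⟨1^k,u⟩⟩, t⟩`; one block succeeds with probability
  `≥ 1/8` (the isolation count), eight blocks with probability `≥ 1 − (7/8)^8 ≥ 1/2`
  (`CoinBlocks.uniformProb_blockOr_ge_half`), and without witnesses every query is a
  NO-instance.  The oracle machine is assembled from the tree's closure theorems only
  (`ttLang_mem_PRel`: truth-table reductions are Turing reductions; Cook transitivity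
  `mem_PRel_of_polyTimeTuringReducible_holds`; `blockOr_mem_PRel`: the block disjunction of a
  `P^O` language is in `P^O`).
* Corollaries: `exWitness_mem_rp_PRelClass` / `exWitness_mem_rp_of_promiseLift` (class form),
  **`NP_subset_rp_PRelClass`**: if every `UniqueWitness (hashRel R)`, `R ∈ P`, is solved by the
  promise lift of a class `C`, then `NP ⊆ rp (P^C)`; and VV86's Corollary
  **`NP_subset_RP_of_uniqueWitness_mem_PromiseP`**: if they are all in `PromiseP` then `NP ⊆ RP`.

No new axioms, no `sorry`; every cited ingredient is a proved theorem of the tree.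
-/

namespace Literature.Computability.Complexity

open _root_.Computability Polynomial Brick Plumb OracleCompose HashBricks Stockmeyer TTClosure Finset

namespace ValiantVazirani

/-! Membership bookkeeping (`memL_sup`, `memL_inf`, `mem_setOf_language`) is reused from
`StockmeyerMachines.lean` / `CoinBlocksOr.lean`; `|sndF z| ≤ |z|` is `OracleCompose.length_boolUnpair_snd_le_length`. -/

/-! ### Instance formats (total parsing) -/

/-- **The existential language of a relation** `R`, total-parsing format: `z` with
`(x, t) = boolUnpair z` is a member iff `x` has an `R`-witness of length `|t|`.
[cite: ValiantVazirani1986, §1] [cite: AroraBarak2009, Def. 2.1] -/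
def ExWitness (R : Language Bool) : Language Bool :=
  {z | 0 < countWitnesses R (sndF z).length (fstF z)}

/-- **The unique-witness promise problem of a relation** `R`: YES = exactly one witness of
length `|t|`, NO = none. [cite: ValiantVazirani1986, §1 (UNIQUE SAT)] -/
def UniqueWitness (R : Language Bool) : PromiseProblem :=
  ⟨{z | countWitnesses R (sndF z).length (fstF z) = 1},
   {z | countWitnesses R (sndF z).length (fstF z) = 0}⟩

/-- Membership in `ExWitness`. [folklore] -/
theorem mem_ExWitness {R : Language Bool} {z : List Bool} :
    z ∈ ExWitness R ↔ 0 < countWitnesses R (sndF z).length (fstF z) :=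
  Iff.rfl

/-! ### The hashed relation

On `w = ⟨x', y⟩` with `x' = ⟨⟨x, t⟩, ⟨κ, u⟩⟩`: `⟨x, y⟩ ∈ R` and `HashesToZero u |t| |κ| y`.  The hash
test is a bounded universal quantifier over the rows `j < |κ|`, each row the parity brick
`HashBricks.andParityFn` against the offset bit (the pattern of `StockMachine.rowLang`). -/

/-- Parser: the instance `x`. [folklore] -/
def xW : List Bool → List Bool := fstF ∘ fstF ∘ fstF
/-- Parser: the length tag `t` (`|t| = m`). [folklore] -/
def tW : List Bool → List Bool := sndF ∘ fstF ∘ fstF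
/-- Parser: the level tag `κ` (`|κ| = k`). [folklore] -/
def kW : List Bool → List Bool := fstF ∘ sndF ∘ fstF
/-- Parser: the coins `u`. [folklore] -/
def uW : List Bool → List Bool := sndF ∘ sndF ∘ fstF
/-- Parser: the witness `y`. [folklore] -/
def yW : List Bool → List Bool := sndF

/-- The parsers are polynomial-time. [folklore] -/
theorem parsers_mem_FP : xW ∈ FP ∧ tW ∈ FP ∧ kW ∈ FP ∧ uW ∈ FP ∧ yW ∈ FP :=
  ⟨comp_mem_FP fstF_mem_FP (comp_mem_FP fstF_mem_FP fstF_mem_FP),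
   comp_mem_FP sndF_mem_FP (comp_mem_FP fstF_mem_FP fstF_mem_FP),
   comp_mem_FP fstF_mem_FP (comp_mem_FP sndF_mem_FP fstF_mem_FP),
   comp_mem_FP sndF_mem_FP (comp_mem_FP sndF_mem_FP fstF_mem_FP), sndF_mem_FP⟩

/-- On the row-test argument `b = ⟨w, 1ʲ⟩`: `1^{j(m+1)}`, the offset of hash row `j`. [folklore] -/
noncomputable def sB : List Bool → List Bool :=
  umulFn ∘ fanoutFn sndF (List.cons true ∘ tW ∘ fstF)
/-- The coins from row `j` on. [folklore] -/
noncomputable def rowB : List Bool → List Bool := dropFn ∘ fanoutFn sB (uW ∘ fstF)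
/-- The inner-product bit of row `j` with `y`. [folklore] -/
noncomputable def dotB : List Bool → List Bool := andParityFn ∘ fanoutFn rowB (yW ∘ fstF)
/-- The offset bit of row `j`. [folklore] -/
noncomputable def offB : List Bool → List Bool :=
  headBitFn ∘ dropFn ∘ fanoutFn (concatFn ∘ fanoutFn sB (tW ∘ fstF)) (uW ∘ fstF)

/-- **The row language**: on `⟨w, 1ʲ⟩`, `|κ| ≤ j` or row `j` hashes `y` to `0`. [folklore] -/
noncomputable def rowLang : Language Bool :=
  (fanoutFn sndF (kW ∘ fstF) ⁻¹' LenLe X) ⊔ {b | dotB b = offB b}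

/-- `rowLang ∈ P`. [folklore] -/
theorem rowLang_mem_P : rowLang ∈ Classes.P := by
  obtain ⟨-, ht, hk, hu, hy⟩ := parsers_mem_FP
  have hs : sB ∈ FP := comp_mem_FP umulFn_mem_FP (fanoutFn_mem_FP sndF_mem_FP
    (comp_mem_FP (cons_mem_FP true) (comp_mem_FP ht fstF_mem_FP)))
  have hrow : rowB ∈ FP :=
    comp_mem_FP dropFn_mem_FP (fanoutFn_mem_FP hs (comp_mem_FP hu fstF_mem_FP))
  have hdot : dotB ∈ FP :=
    comp_mem_FP andParityFn_mem_FP (fanoutFn_mem_FP hrow (comp_mem_FP hy fstF_mem_FP))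
  have hoff : offB ∈ FP := comp_mem_FP headBitFn_mem_FP (comp_mem_FP dropFn_mem_FP
    (fanoutFn_mem_FP (comp_mem_FP concatFn_mem_FP (fanoutFn_mem_FP hs (comp_mem_FP ht fstF_mem_FP)))
      (comp_mem_FP hu fstF_mem_FP)))
  exact union_mem_P
    (preimage_mem_P (LenLe_mem_P X) (fanoutFn_mem_FP sndF_mem_FP (comp_mem_FP hk fstF_mem_FP)))
    (setOf_apply_eq_apply_mem_P hdot hoff)

/-- **The hash test** as a bounded quantifier over the rows. [folklore] -/
noncomputable def hzLang : Language Bool := ballLang (X + 1) rowLang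

/-- `hzLang ∈ P`. [folklore] -/
theorem hzLang_mem_P : hzLang ∈ Classes.P := ballLang_mem_P _ rowLang_mem_P

/-- **The hashed relation** `{⟨⟨⟨x,t⟩,⟨κ,u⟩⟩, y⟩ | ⟨x,y⟩ ∈ R ∧ HashesToZero u |t| |κ| y}`.
[cite: ValiantVazirani1986, proof of Thm. 1.1] [cite: AroraBarak2009, proof of Thm. 17.18] -/
noncomputable def hashRel (R : Language Bool) : Language Bool :=
  (fanoutFn xW yW ⁻¹' R) ⊓ hzLang

/-- `hashRel R ∈ P` for `R ∈ P`. [cite: AroraBarak2009, proof of Thm. 17.18] -/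
theorem hashRel_mem_P {R : Language Bool} (hR : R ∈ Classes.P) : hashRel R ∈ Classes.P := by
  obtain ⟨hx, -, -, -, hy⟩ := parsers_mem_FP
  exact inter_mem_P (preimage_mem_P hR (fanoutFn_mem_FP hx hy)) hzLang_mem_P

section Semantics

variable (x t κ u y : List Bool)

/-- The hashed instance `⟨⟨x, t⟩, ⟨κ, u⟩⟩`. [folklore] -/
def hinst : List Bool := boolPair (boolPair x t) (boolPair κ u)

/-- Parsing a well-formed argument. [folklore] -/
theorem parse_hinst :
    xW (boolPair (hinst x t κ u) y) = x ∧ tW (boolPair (hinst x t κ u) y) = t ∧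
      kW (boolPair (hinst x t κ u) y) = κ ∧ uW (boolPair (hinst x t κ u) y) = u ∧
      yW (boolPair (hinst x t κ u) y) = y := by
  simp [xW, tW, kW, uW, yW, hinst]

/-- **Semantics of the row test.** [folklore] -/
theorem mem_rowLang_iff (j : ℕ) :
    boolPair (boolPair (hinst x t κ u) y) (ones j) ∈ rowLang ↔
      κ.length ≤ j ∨ rowParity u t.length y j = false := by
  obtain ⟨-, ht, hk, hu, hy⟩ := parse_hinst x t κ u y
  set a := boolPair (hinst x t κ u) y
  have hs : sB (boolPair a (ones j)) = ones (j * (t.length + 1)) := by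
    rw [sB, Function.comp_apply, umulFn_apply, fanoutFn_apply, fstF_boolPair, sndF_boolPair,
      sndF_boolPair, Function.comp_apply, Function.comp_apply, fstF_boolPair, ht]
    simp [ones]
  have hdot : dotB (boolPair a (ones j)) =
      [decide (Odd (((u.drop (j * (t.length + 1))).zipWith (· && ·) y).count true))] := by
    rw [dotB, Function.comp_apply, fanoutFn_apply, rowB, Function.comp_apply, fanoutFn_apply, hs,
      Function.comp_apply, fstF_boolPair, hu, dropFn_boolPair, Function.comp_apply, fstF_boolPair,
      hy, andParityFn_boolPair, ones, List.length_replicate]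
  have hoff : offB (boolPair a (ones j)) = [coinBit u (j * (t.length + 1) + t.length)] := by
    rw [offB, Function.comp_apply, Function.comp_apply, fanoutFn_apply, Function.comp_apply,
      fanoutFn_apply, hs, Function.comp_apply, fstF_boolPair, ht, concatFn_boolPair,
      Function.comp_apply, fstF_boolPair, hu, dropFn_boolPair, headBitFn_apply,
      StockMachine.headD_drop]
    simp [ones]
  rw [rowLang, StockMachine.memL_sup, memL_preimage, fanoutFn_apply, sndF_boolPair, Function.comp_apply,
    fstF_boolPair, hk, boolPair_mem_LenLe, CoinBlocks.mem_setOf_language, hdot, hoff, rowParity, rowStart]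
  simp only [ones, List.length_replicate, eval_X, List.cons.injEq, and_true]
  constructor
  · rintro (h | h)
    · exact Or.inl h
    · exact Or.inr (by rw [h]; simp)
  · rintro (h | h)
    · exact Or.inl h
    · refine Or.inr ?_
      revert h
      cases decide (Odd (List.count true (List.zipWith (fun x1 x2 => x1 && x2)
          (List.drop (j * (t.length + 1)) u) y))) <;>
        cases coinBit u (j * (t.length + 1) + t.length) <;> simp

/-- **Semantics of the hash test.** [folklore] -/
theorem mem_hzLang_iff :
    boolPair (hinst x t κ u) y ∈ hzLang ↔ HashesToZero u t.length κ.length y := by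
  have hk : κ.length ≤ (boolPair (hinst x t κ u) y).length := by
    simp only [hinst, length_boolPair]; omega
  rw [hzLang, mem_ballLang]
  simp only [eval_add, eval_X, eval_one, ← ones.eq_1]
  constructor
  · intro h i hi
    have := (mem_rowLang_iff x t κ u y i).1 (h i (by omega))
    exact this.resolve_left (by omega)
  · intro h i hi
    exact (mem_rowLang_iff x t κ u y i).2
      (if hki : κ.length ≤ i then Or.inl hki else Or.inr (h i (by omega)))

/-- **Semantics of the hashed relation.** [cite: AroraBarak2009, proof of Thm. 17.18] -/
theorem mem_hashRel_iff (R : Language Bool) :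
    boolPair (hinst x t κ u) y ∈ hashRel R ↔ boolPair x y ∈ R ∧ HashesToZero u t.length κ.length y := by
  obtain ⟨hx, -, -, -, hy⟩ := parse_hinst x t κ u y
  rw [hashRel, StockMachine.memL_inf, memL_preimage, fanoutFn_apply, hx, hy, mem_hzLang_iff]

end Semantics

/-- **The witness count of the hashed relation is the level count**:
`#{y | ⟨⟨⟨x,t⟩,⟨κ,u⟩⟩, y⟩ ∈ hashRel R} = levelCount R |t| x u |κ|`. [cite: AroraBarak2009, proof of Thm. 17.18] -/
theorem countWitnesses_hashRel (R : Language Bool) (x t κ u : List Bool) :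
    countWitnesses (hashRel R) t.length (hinst x t κ u) = levelCount R t.length x u κ.length := by
  classical
  unfold countWitnesses levelCount
  exact congrArg Finset.card (Finset.filter_congr fun w _ => mem_hashRel_iff x t κ u w.toList R)

/-! ### The level search: one truth-table round over the levels `k` -/

/-- Parser on the level-search argument `a = ⟨⟨z, u⟩, 1ᵏ⟩`: `z`. [folklore] -/
def zA : List Bool → List Bool := fstF ∘ fstF
/-- Parser: the coins `u`. [folklore] -/
def uA : List Bool → List Bool := sndF ∘ fstF
/-- Parser: the level tag `1ᵏ`. [folklore] -/
def kA : List Bool → List Bool := sndF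

/-- **The query generator**: on `⟨⟨z, u⟩, 1ᵏ⟩` with `(x, t) = boolUnpair z`, the hashed instance
`⟨⟨⟨x, t⟩, ⟨1ᵏ, u⟩⟩, t⟩` (a `UniqueWitness (hashRel R)` instance with witness length `|t|`).
[cite: ValiantVazirani1986, proof of Thm. 1.1] -/
noncomputable def qryA : List Bool → List Bool :=
  fanoutFn (fanoutFn (fanoutFn (fstF ∘ zA) (sndF ∘ zA)) (fanoutFn kA uA)) (sndF ∘ zA)

/-- `qryA ∈ FP`. [folklore] -/
theorem qryA_mem_FP : qryA ∈ FP := by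
  have hz : zA ∈ FP := comp_mem_FP fstF_mem_FP fstF_mem_FP
  exact fanoutFn_mem_FP (fanoutFn_mem_FP (fanoutFn_mem_FP (comp_mem_FP fstF_mem_FP hz)
    (comp_mem_FP sndF_mem_FP hz)) (fanoutFn_mem_FP sndF_mem_FP (comp_mem_FP sndF_mem_FP fstF_mem_FP)))
    (comp_mem_FP sndF_mem_FP hz)

/-- The query on a well-formed argument. [folklore] -/
theorem qryA_boolPair (z u κ : List Bool) :
    qryA (boolPair (boolPair z u) κ) = boolPair (hinst (fstF z) (sndF z) κ u) (sndF z) := by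
  simp [qryA, zA, uA, kA, hinst]

/-- **The level-search language** relative to `A`: `⟨z, u⟩` is a member iff for some level
`k < |⟨z, u⟩|` the oracle accepts the hashed instance `⟨⟨⟨x,t⟩,⟨1ᵏ,u⟩⟩, t⟩`.
[cite: ValiantVazirani1986, proof of Thm. 1.1] [cite: AroraBarak2009, proof of Thm. 17.18] -/
noncomputable def levelSearch (A : Language Bool) : Language Bool :=
  ttLang qryA X (sndF ⁻¹' HasBit true) A

/-- `levelSearch A ∈ P^A` (a truth-table reduction is a Turing reduction). [cite: LadnerLynchSelman1975, §3] -/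
theorem levelSearch_mem_PRel (A : Language Bool) :
    levelSearch A ∈ PRel (Oracle.ofLanguage A) :=
  ttLang_mem_PRel qryA_mem_FP (preimage_mem_P (HasBit_mem_P true) sndF_mem_FP) A

/-- Some answer bit is `true` iff some query is accepted. [folklore] -/
theorem true_mem_ttBits_iff (Q : List Bool → List Bool) (A : Language Bool) (w : List Bool) (n : ℕ) :
    true ∈ ttBits Q A w n ↔ ∃ i < n, Q (boolPair w (List.replicate i true)) ∈ A := by
  simp [ttBits, boolIndicator_eq_true_iff']

/-- **Semantics of the level search.** [folklore] -/
theorem boolPair_mem_levelSearch_iff (A : Language Bool) (z u : List Bool) :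
    boolPair z u ∈ levelSearch A ↔ ∃ k < (boolPair z u).length,
      boolPair (hinst (fstF z) (sndF z) (List.replicate k true) u) (sndF z) ∈ A := by
  rw [levelSearch, mem_ttLang_iff, memL_preimage, sndF_boolPair, mem_HasBit, eval_X,
    true_mem_ttBits_iff]
  simp only [qryA_boolPair]

/-! ### The block disjunction of a `P^O` language is in `P^O` -/

/-- **The block query generator**: on `⟨w, 1ʲ⟩` with `(z, r) = boolUnpair w`, the pair
`⟨z, block_j r⟩` (blocks of length `ℓ(|z|)`). [cite: AroraBarakCC2009, §7.4.1] -/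
noncomputable def blkQ (ℓ : Polynomial ℕ) : List Bool → List Bool :=
  fanoutFn (fstF ∘ fstF)
    (takeFn ∘ fanoutFn (polyFn ℓ ∘ fstF ∘ fstF)
      (dropFn ∘ fanoutFn (umulFn ∘ fanoutFn sndF (polyFn ℓ ∘ fstF ∘ fstF)) (sndF ∘ fstF)))

/-- `blkQ ℓ ∈ FP`. [folklore] -/
theorem blkQ_mem_FP (ℓ : Polynomial ℕ) : blkQ ℓ ∈ FP := by
  have hr : (polyFn ℓ ∘ fstF ∘ fstF) ∈ FP :=
    comp_mem_FP (polyFn_mem_FP ℓ) (comp_mem_FP fstF_mem_FP fstF_mem_FP)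
  exact fanoutFn_mem_FP (comp_mem_FP fstF_mem_FP fstF_mem_FP) (comp_mem_FP takeFn_mem_FP
    (fanoutFn_mem_FP hr (comp_mem_FP dropFn_mem_FP (fanoutFn_mem_FP
      (comp_mem_FP umulFn_mem_FP (fanoutFn_mem_FP sndF_mem_FP hr)) (comp_mem_FP sndF_mem_FP fstF_mem_FP)))))

/-- The block query on `⟨w, 1ʲ⟩`. [folklore] -/
theorem blkQ_boolPair (ℓ : Polynomial ℕ) (w : List Bool) (j : ℕ) :
    blkQ ℓ (boolPair w (List.replicate j true)) =
      boolPair (fstF w) (blk (sndF w) (ℓ.eval (fstF w).length) j) := by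
  simp [blkQ, fanoutFn_apply, umulFn_apply, polyFn_apply, takeFn_boolPair, dropFn_boolPair, blk, ones]

/-- **The block disjunction as a truth-table reduction** (constant number of blocks).
[cite: AroraBarakCC2009, §7.4.1] -/
theorem blockOr_eq_ttLang (B : Language Bool) (ℓ K : Polynomial ℕ) (hK : ∀ a b, K.eval a = K.eval b) :
    CoinBlocks.blockOr B ℓ K = ttLang (blkQ ℓ) K (sndF ⁻¹' HasBit true) B := by
  ext w
  rw [CoinBlocks.blockOr, CoinBlocks.mem_setOf_language, mem_ttLang_iff, memL_preimage, sndF_boolPair,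
    mem_HasBit, true_mem_ttBits_iff, hK (boolUnpair w).1.length w.length]
  simp only [blkQ_boolPair]
  rfl

/-- **`P^O` is closed under block disjunctions** with constantly many blocks.
[cite: AroraBarakCC2009, §7.4.1] [cite: LadnerLynchSelman1975, §3] -/
theorem blockOr_mem_PRel {O : Oracle} {B : Language Bool} (hB : B ∈ PRel O) (ℓ K : Polynomial ℕ)
    (hK : ∀ a b, K.eval a = K.eval b) : CoinBlocks.blockOr B ℓ K ∈ PRel O := by
  rw [blockOr_eq_ttLang B ℓ K hK]
  exact mem_PRel_of_polyTimeTuringReducible_holds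
    (ttLang_mem_PRel (blkQ_mem_FP ℓ) (preimage_mem_P (HasBit_mem_P true) sndF_mem_FP) B) hB

/-! ### The reduction -/

section Reduction

variable (R : Language Bool) {A : Language Bool}

/-- **YES side**: if `x` has a witness, one coin block of length `ℓ ≥ (m+2)(m+1)` makes the level
search accept with probability `≥ 1/8`. [cite: ValiantVazirani1986, Thm. 1.1] [cite: AroraBarak2009, Lemma 17.19] -/
theorem uniformProb_levelSearch_ge (hY : (UniqueWitness (hashRel R)).yes ≤ A) {z : List Bool}
    (hz : z ∈ ExWitness R) {ℓ : ℕ} (hℓ : ((sndF z).length + 2) * ((sndF z).length + 1) ≤ ℓ) :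
    (1 : ℝ) / 8 ≤ uniformProb ℓ {u | boolPair z u ∈ levelSearch A} := by
  classical
  set m := (sndF z).length with hm
  have hiso := card_le_eight_mul_card_isolating R (fstF z) (m := m) (ℓ := ℓ) hz hℓ
  rw [card_vector, Fintype.card_bool] at hiso
  have hsub : (univ.filter fun u : List.Vector Bool ℓ => ∃ k ≤ m + 2, levelCount R m (fstF z) u.toList k = 1).card
      ≤ cnt ℓ {u | boolPair z u ∈ levelSearch A} := by
    unfold cnt
    refine Finset.card_le_card fun u hu => ?_
    simp only [Finset.mem_filter, Finset.mem_univ, true_and] at hu ⊢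
    obtain ⟨k, hk, hcount⟩ := hu
    rw [Set.mem_setOf_eq, boolPair_mem_levelSearch_iff]
    have hmz : m ≤ z.length := length_boolUnpair_snd_le_length z
    refine ⟨k, ?_, hY ?_⟩
    · rw [length_boolPair, List.Vector.toList_length]; nlinarith
    · show countWitnesses (hashRel R) (sndF (boolPair (hinst (fstF z) (sndF z) (List.replicate k true) u.toList)
          (sndF z))).length (fstF _) = 1
      rw [sndF_boolPair, fstF_boolPair, ← hm, countWitnesses_hashRel, List.length_replicate, hcount]
  rw [uniformProb_eq_cnt_div, le_div_iff₀ (by positivity)]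
  have h1 : ((2 : ℕ) ^ ℓ : ℝ) ≤ 8 * (cnt ℓ {u | boolPair z u ∈ levelSearch A} : ℝ) := by
    exact_mod_cast hiso.trans (Nat.mul_le_mul_left 8 hsub)
  push_cast at h1
  linarith

/-- **NO side**: without witnesses every query is a NO-instance, so the level search rejects
every coin block. [cite: ValiantVazirani1986, Thm. 1.1] -/
theorem boolPair_not_mem_levelSearch (hN : (UniqueWitness (hashRel R)).no ≤ Aᶜ) {z : List Bool}
    (hz : z ∉ ExWitness R) (u : List Bool) : boolPair z u ∉ levelSearch A := by
  rw [boolPair_mem_levelSearch_iff]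
  rintro ⟨k, -, hkA⟩
  have hzero : countWitnesses R (sndF z).length (fstF z) = 0 := by
    rw [mem_ExWitness] at hz; omega
  refine hN ?_ hkA
  show countWitnesses (hashRel R) (sndF (boolPair (hinst (fstF z) (sndF z) (List.replicate k true) u)
      (sndF z))).length (fstF _) = 0
  rw [sndF_boolPair, fstF_boolPair, countWitnesses_hashRel]
  have : levelCount R (sndF z).length (fstF z) u (List.replicate k true).length ≤
      countWitnesses R (sndF z).length (fstF z) := by
    classical
    unfold countWitnesses levelCount
    exact Finset.card_le_card fun w hw => by
      simp only [Finset.mem_filter, Finset.mem_univ, true_and] at hw ⊢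
      exact hw.1
  omega

/-- The coin-block length `(n+2)(n+1)` and its evaluation. [folklore] -/
theorem eval_blockLen (n : ℕ) : ((X + 2) * (X + 1) : ℕ[X]).eval n = (n + 2) * (n + 1) := by
  simp

/-- **Valiant–Vazirani (oracle form): `ExWitness R ∈ RP^A`** for every language `A` that accepts
the YES-instances and rejects the NO-instances of `UniqueWitness (hashRel R)`.
(VV86 Thm. 1.1: SAT is reducible to UNIQUE-SAT by a randomized polynomial-time reduction with
one-sided success probability `Ω(1)`, here amplified to `1/2` over `8` independent hash blocks.)
[cite: ValiantVazirani1986, Thm. 1.1] [cite: AroraBarak2009, Thm. 17.18] -/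
theorem exWitness_mem_rp (hY : (UniqueWitness (hashRel R)).yes ≤ A)
    (hN : (UniqueWitness (hashRel R)).no ≤ Aᶜ) :
    ExWitness R ∈ rp (PRel (Oracle.ofLanguage A)) := by
  have hK : ∀ a b, (C 7 + 1 : ℕ[X]).eval a = (C 7 + 1 : ℕ[X]).eval b := fun a b => by simp
  refine ⟨CoinBlocks.blockOr (levelSearch A) ((X + 2) * (X + 1)) (C 7 + 1),
    blockOr_mem_PRel (levelSearch_mem_PRel A) _ _ hK, (C 7 + 1) * ((X + 2) * (X + 1)),
    fun z => ⟨fun hz => ?_, fun hz v hv => ?_⟩⟩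
  · rw [eval_mul, eval_add, eval_one]
    refine CoinBlocks.uniformProb_blockOr_ge_half ?_
    rw [eval_C, eval_blockLen]
    have h := uniformProb_levelSearch_ge R hY hz (ℓ := (z.length + 2) * (z.length + 1))
      (Nat.mul_le_mul (by have : (sndF z).length ≤ z.length := length_boolUnpair_snd_le_length z; omega)
        (by have : (sndF z).length ≤ z.length := length_boolUnpair_snd_le_length z; omega))
    norm_num
    exact h
  · rw [eval_mul, eval_add, eval_one] at hv
    exact CoinBlocks.boolPair_not_mem_blockOr (fun u _ => boolPair_not_mem_levelSearch R hN hz u) hv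

/-- **Class form**: if some `A ∈ C` solves `UniqueWitness (hashRel R)` then
`ExWitness R ∈ rp (P^C)`. [cite: ValiantVazirani1986, Thm. 1.1] -/
theorem exWitness_mem_rp_PRelClass {C : Set (Language Bool)} (hA : A ∈ C)
    (hY : (UniqueWitness (hashRel R)).yes ≤ A) (hN : (UniqueWitness (hashRel R)).no ≤ Aᶜ) :
    ExWitness R ∈ rp (PRelClass C) :=
  rp_mono (fun _ hL => mem_PRelClass_iff.2 ⟨A, hA, hL⟩) (exWitness_mem_rp R hY hN)

/-- **Promise form**: `UniqueWitness (hashRel R) ∈ promiseLift C ⟹ ExWitness R ∈ rp (P^C)`.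
[cite: ValiantVazirani1986, Thm. 1.1] -/
theorem exWitness_mem_rp_of_promiseLift {C : Set (Language Bool)}
    (h : UniqueWitness (hashRel R) ∈ promiseLift C) : ExWitness R ∈ rp (PRelClass C) := by
  obtain ⟨A, hA, hY, hN⟩ := h
  exact exWitness_mem_rp_PRelClass R hA hY hN

end Reduction

/-! ### From relations to `NP` -/

/-- `P^C` is closed under polynomial-time preimages. [cite: LadnerLynchSelman1975, §2] -/
theorem preimage_mem_PRelClass {C : Set (Language Bool)} {L : Language Bool} (hL : L ∈ PRelClass C)
    {g : List Bool → List Bool} (hg : g ∈ FP) : g ⁻¹' L ∈ PRelClass C := by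
  obtain ⟨A, hA, hLA⟩ := mem_PRelClass_iff.1 hL
  exact mem_PRelClass_iff.2 ⟨A, hA, preimage_mem_PRel hLA hg⟩

/-- **`rp K` is closed under polynomial-time many-one reductions of polynomial length** when `K`
is closed under polynomial-time preimages (the coins are re-addressed through the reduction).
[cite: AroraBarak2009, §7.3 (robustness of the definitions)] -/
theorem preimage_mem_rp {K : Set (Language Bool)}
    (hK : ∀ ⦃L : Language Bool⦄, L ∈ K → ∀ ⦃g : List Bool → List Bool⦄, g ∈ FP → g ⁻¹' L ∈ K)
    {L₁ : Language Bool} (hL₁ : L₁ ∈ rp K) {f : List Bool → List Bool} (hf : f ∈ FP)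
    {s : Polynomial ℕ} (hs : ∀ x, (f x).length = s.eval x.length) : f ⁻¹' L₁ ∈ rp K := by
  obtain ⟨L', hL', p, hp⟩ := hL₁
  refine ⟨fanoutFn (f ∘ fstF) sndF ⁻¹' L',
    hK hL' (fanoutFn_mem_FP (comp_mem_FP hf fstF_mem_FP) sndF_mem_FP), p.comp s, fun x => ?_⟩
  have key : ∀ y : List Bool,
      @Membership.mem (List Bool) (Language Bool) _ (fanoutFn (f ∘ fstF) sndF ⁻¹' L') (boolPair x y) ↔
        boolPair (f x) y ∈ L' := fun y => by
    rw [memL_preimage, fanoutFn_apply, Function.comp_apply, fstF_boolPair, sndF_boolPair]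
  have hev : (p.comp s).eval x.length = p.eval (f x).length := by rw [eval_comp, hs]
  have hset : {y : List Bool | @Membership.mem (List Bool) (Language Bool) _
      (fanoutFn (f ∘ fstF) sndF ⁻¹' L') (boolPair x y)} = {y | boolPair (f x) y ∈ L'} :=
    Set.ext key
  refine ⟨fun hx => ?_, fun hx y hy h => ?_⟩
  · have h1 := (hp (f x)).1 (memL_preimage.1 hx)
    rw [hev]
    calc (1 : ℝ) / 2 ≤ uniformProb (p.eval (f x).length) {y | boolPair (f x) y ∈ L'} := h1
      _ = _ := by rw [← hset]
  · rw [hev] at hy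
    exact (hp (f x)).2 (fun h' => hx (memL_preimage.2 h')) y hy ((key y).1 h)

/-- **`NP ⊆ RP^C` if `C` solves the unique-witness promise problems of the hashed `P`
relations.** (VV86, Thm. 1.1 and the remark after it, class form: the `NP` witness relation is
first normalised to witnesses of one exact length — one flag coin and self-delimited cells, the
tree's `CoinMaps.decT` — and the instance is tagged with that length.)
[cite: ValiantVazirani1986, Thm. 1.1] [cite: AroraBarak2009, Thm. 17.18] -/
theorem NP_subset_rp_PRelClass {C : Set (Language Bool)}
    (h : ∀ R ∈ Classes.P, UniqueWitness (hashRel R) ∈ promiseLift C) :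
    Nondeterministic.NP ⊆ rp (PRelClass C) := by
  rintro L ⟨L', hL', p, hp⟩
  set R' : Language Bool := CoinMaps.decT.eval ⁻¹' L' with hR'
  have hR'P : R' ∈ Classes.P := preimage_mem_P hL' CoinMaps.decT_mem_FP
  set f : List Bool → List Bool := fanoutFn (id : List Bool → List Bool) (polyFn (2 * p + 1)) with hf
  have hfFP : f ∈ FP := fanoutFn_mem_FP id_mem_FP (polyFn_mem_FP _)
  have hfx : ∀ x, f x = boolPair x (ones (2 * p.eval x.length + 1)) := fun x => by
    simp [hf, fanoutFn_apply, polyFn_apply]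
  have hlen : ∀ x, (f x).length = (2 * X + 3 + 2 * p : ℕ[X]).eval x.length := fun x => by
    rw [hfx, length_boolPair]
    simp [ones]
    ring
  have hL : L = f ⁻¹' ExWitness R' := by
    ext x
    rw [memL_preimage, hfx, mem_ExWitness, fstF_boolPair, sndF_boolPair, hp x,
      PPSharpP.countWitnesses_eq_cnt, cnt_pos_iff]
    simp only [ones, List.length_replicate]
    constructor
    · rintro ⟨y, hy, hyL⟩
      refine ⟨false :: (CoinMaps.enc y ++ List.replicate (2 * p.eval x.length - 2 * y.length) false),
        by simp; omega, ?_⟩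
      show CoinMaps.decT.eval (boolPair x (false :: _)) ∈ L'
      rw [CoinMaps.decT_eval, CoinMaps.dec_enc_append_replicate]
      exact hyL
    · rintro ⟨y', hy', hmem⟩
      cases y' with
      | nil => simp at hy'
      | cons b y'' =>
        have hdec := CoinMaps.two_mul_length_dec_le y''
        refine ⟨CoinMaps.dec y'', by simp at hy'; omega, ?_⟩
        have hmem' : CoinMaps.decT.eval (boolPair x (b :: y'')) ∈ L' := hmem
        rwa [CoinMaps.decT_eval] at hmem'
  rw [hL]
  exact preimage_mem_rp (K := PRelClass C) (fun _ hM _ hg => preimage_mem_PRelClass hM hg)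
    (exWitness_mem_rp_of_promiseLift R' (h R' hR'P)) hfFP hlen

/-- **Valiant–Vazirani's Corollary: if UNIQUE-witness detection is in promise-`P` then
`NP ⊆ RP`** (hence `NP = RP`). [cite: ValiantVazirani1986, Cor. to Thm. 1.1 ("if UNIQUE SAT ∈ RP then NP = RP")] -/
theorem NP_subset_RP_of_uniqueWitness_mem_PromiseP
    (h : ∀ R ∈ Classes.P, UniqueWitness (hashRel R) ∈ PromiseP) : Nondeterministic.NP ⊆ RP :=
  (NP_subset_rp_PRelClass (C := Classes.P) h).trans (rp_mono PRelClass_P_subset_P)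

end ValiantVazirani

end Literature.Computability.Complexity
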